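import Mathlib
import Summits.KontsevichZagierPeriods.Zeta5Search.PalindromicUBound
import Summits.KontsevichZagierPeriods.Zeta5Search.FloorInequalityUProof
import Summits.KontsevichZagierPeriods.Zeta5Search.ConstantTermFloorWindow
import HarnessLib

/-!
# ζ(5) search — the `U`-law `v_p(U(b)) ≥ law_U = min(1,⌊d/p⌋) − 1 − N_p(b)` IS A THEOREM in the window `p² > b₀ + 2`

Cell `pub-zeta5` (HONEST FRAMING: systematic search; no irrationality claim unless certified), typer seat
generation 9.  The ζ(5)-coefficient companion of `Zeta3LawWindow.lean`: gen-2's right-hand side `law_U` (`ClusterValuation.lawU`,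
the single-coefficient form of (P̂V)) bounds `v_p(U(b))` from below at every window prime:

* `uLaw_window : InPolytope b → p.Prime → 5 ≤ p → b₀ + 2 < p² → U(b) ≠ 0 → lawU b p ≤ v_p(U(b))`.

PROOF: `U = Σ_x U_x` classwise; `U_x = 0` without poles, `v(U_x) ≥ 0 ≥ law_U` for a single-pole class (Theorem A′, (T1-iv)
`lawUNonpos_holds`), and `v(U_x) ≥ T_x(5) ≥ law_U` for a multipole class (Theorem A + the palindrome bonus
`padicNorm_classUsum_le_classBound`, typer g9; (T1-v) `floorInequalityU_holds`, typer g8).  For `p > b₀` there is no multipole class.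
`p`-adic valuations of rational numbers; nothing about irrationality.
-/

noncomputable section

open Finset

namespace Summit.KontsevichZagierPeriods.Zeta5Search.ClusterValuation

open Summit.KontsevichZagierPeriods.Zeta5Search.DualSeries (InBox)
open Summit.KontsevichZagierPeriods.Zeta5Search.WedgeDictionary (coeffU pfData dOf)
open Summit.KontsevichZagierPeriods.Zeta5Search.CasoratianValuation (InPolytope pairFloors refund)
open Summit.KontsevichZagierPeriods.Zeta5Search.PadicSeries

/-- **THE `U`-LAW IN THE WINDOW.**  For `b` in the polytope and every prime `p ≥ 5` with `p² > b₀ + 2`: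
`v_p(U(b)) ≥ min(1,⌊d/p⌋) − 1 − N_p(b)`. -/
theorem uLaw_window (b : ℕ → ℤ) (p : ℕ) (hb : InPolytope b) (hprime : p.Prime) (hp5 : 5 ≤ p)
    (hwin : (b 0 + 2 : ℤ) < (p : ℤ) ^ 2) (hU : coeffU b ≠ 0) :
    lawU b p ≤ padicValRat p (coeffU b) := by
  haveI : Fact p.Prime := ⟨hprime⟩
  have hp0 : 0 < p := hprime.pos
  have h0 : 0 ≤ b 0 := hb.1.1
  have hlaw0 : lawU b p ≤ 0 := lawUNonpos_holds b p hb hp5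
  have hodd : ¬ 2 ∣ p := by
    intro h2
    have := (Nat.prime_dvd_prime_iff_eq Nat.prime_two hprime).1 h2
    omega
  apply val_ge_of_padicNorm_le hU
  rw [coeffU, ← sum_classSet_eq b hp0]
  refine padicNorm.sum_le' (fun x hx => ?_) (zpow_p_nonneg _)
  have hx' := mem_range.1 hx
  rcases Nat.lt_trichotomy (classPoleCount b p x) 1 with hc | hc | hc
  · rw [classUsum_eq_zero_of_noPole b hb (by omega), padicNorm.zero]; exact zpow_p_nonneg _
  · refine (padicNorm_classUsum_le_one b hb hp5 hwin hc).trans ?_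
    rw [← zpow_zero (p : ℚ)]
    exact zpow_le_zpow_right₀ one_le_p (by linarith)
  · -- a multipole class exists, so `p ≤ b₀`, and (T1-v) applies
    obtain ⟨u, hu, v, hv, huv⟩ := one_lt_card.1 (by unfold classPoleCount at hc; omega :
      1 < ((classSet b p x).filter fun s => netExp b s < 0).card)
    have hpn := p_le_of_two_mem b hp0 (mem_filter.1 hu).1 (mem_filter.1 hv).1 huv
    have hb0 : (((b 0).toNat : ℕ) : ℤ) = b 0 := Int.toNat_of_nonneg h0
    have hpb : (p : ℤ) ≤ b 0 := by omega
    have hT := floorInequalityU_holds b p x hb hp5 hodd hpb hwin hx'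
    exact (padicNorm_classUsum_le_classBound b hb hp5 hwin hx' (by omega)).trans
      (zpow_le_zpow_right₀ one_le_p (by linarith))

end Summit.KontsevichZagierPeriods.Zeta5Search.ClusterValuation

end
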